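import Mathlib
import Literature.RepresentationTheory.FiniteGroups.KLRGradedCellularBasis
import Summits.MatrixMultiplication.MatrixMultiplication.Theorems.SnSubsetDichotomyNoThresholdSubsetTripleBlockCentering

/-!
# `SnSubsetDichotomy.NoThresholdSubsetTriple`, line `one-point-chernoff`:
# stub `stub_window_of_onePointChernoff` (bridge: one-point Chernoff functional → window count)

Index set: `i : TableauPair n`, the same-shape pairs `(μ, S, T)` of standard tableaux with `n`
cells. Write `X i = TableauPair.degree 2 i = deg₂ S + deg₂ T` and `w i = c₀ − (c₀ − c₁)²` with
`cⱼ = TableauPair.content 2 i j` (the `2`-block weight of the shape), and `a i = ⌊(2 w i + 2)/3⌋`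
(Lean's integer division) for the cut of the window count `2·#{X < a} + #{2a ≤ X}`.

The one-point Chernoff functional (C1) bounds
`S(n) = ∑_i exp(θ·((2/3)·w i − X i)/√n) ≤ n!·e^{-c√n}` for one `θ > 0` and all large `n`.
This file derives the WINDOW bound `2·#{X < a} + #{2a ≤ X} ≤ n!·e^{-(c/2)√n}` from it:

* lower count (Markov): `X < a` and `3a ≤ 2w + 2` give `3X ≤ 2w`, so the `i`-th term of `S(n)`
  is `≥ 1` and `#{X < a} ≤ S(n)`;
* upper count: along the content-preserving bijection `e` of `TableauPair n` with
  `X (e i) − w i = −(X i − w i)` (tree theorem `KlrLine.exists_equiv_degree_sub_weight_neg`,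
  the transpose map) the set `{2a ≤ X}` is in bijection with `{X ≤ 2w − 2a}`, on which
  `3X ≤ 6w − 6a ≤ 2w` (as `2w ≤ 3a`), so again every term is `≥ 1` and `#{2a ≤ X} ≤ S(n)`;
* constants: `3·n!·e^{-c√n} ≤ n!·e^{-(c/2)√n}` once `3 ≤ e^{(c/2)√n}`.

The counting is done for an arbitrary family of `ℤ`-valued `X, w` on finite types carrying such
a bijection (`window_of_chernoff_abstract`), then specialised.
-/

namespace Summit.MatrixMultiplication.MatrixMultiplication.Theorems

open Literature.RepresentationTheory.FiniteGroups (TableauPair KLRGradedCellularBasis residueContent tableauDegree)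
open scoped BigOperators

namespace KlrLine

/-- Pointwise Markov step: `3X ≤ 2w`, `θ ≥ 0`, `s ≥ 0` give `1 ≤ e^{θ((2/3)w − X)/s}`.
[folklore] -/
private theorem one_le_exp_tilt {X w : ℤ} (h : 3 * X ≤ 2 * w) {θ s : ℝ} (hθ : 0 ≤ θ)
    (hs : 0 ≤ s) :
    (1 : ℝ) ≤ Real.exp (θ * ((2 / 3 : ℝ) * (w : ℝ) - (X : ℝ)) / s) := by
  apply Real.one_le_exp
  have h' : (3 : ℝ) * (X : ℝ) ≤ 2 * (w : ℝ) := by exact_mod_cast h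
  have ht : 0 ≤ (2 / 3 : ℝ) * (w : ℝ) - (X : ℝ) := by linarith
  exact div_nonneg (mul_nonneg hθ ht) hs

/-- Markov on a finite sum: if every `i` with `P i` has `3·X i ≤ 2·w i`, then
`#{i // P i} ≤ ∑_i e^{θ((2/3)w i − X i)/s}` (`θ, s ≥ 0`): each term on the set is `≥ 1`
(`one_le_exp_tilt`) and all terms are positive. [folklore] -/
private theorem card_le_sum_exp_tilt {α : Type*} [Fintype α] (X w : α → ℤ) (P : α → Prop)
    (hP : ∀ i, P i → 3 * X i ≤ 2 * w i) {θ s : ℝ} (hθ : 0 ≤ θ) (hs : 0 ≤ s) :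
    (Nat.card {i // P i} : ℝ) ≤
      ∑ i, Real.exp (θ * ((2 / 3 : ℝ) * (w i : ℝ) - (X i : ℝ)) / s) := by
  classical
  have hpt : ∀ i ∈ Finset.univ.filter P,
      (1 : ℝ) ≤ Real.exp (θ * ((2 / 3 : ℝ) * (w i : ℝ) - (X i : ℝ)) / s) :=
    fun i hi => one_le_exp_tilt (hP i (Finset.mem_filter.1 hi).2) hθ hs
  have h1 := Finset.card_nsmul_le_sum _ _ _ hpt
  rw [nsmul_eq_mul, mul_one] at h1
  have h2 : ∑ i ∈ Finset.univ.filter P,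
      Real.exp (θ * ((2 / 3 : ℝ) * (w i : ℝ) - (X i : ℝ)) / s) ≤
      ∑ i, Real.exp (θ * ((2 / 3 : ℝ) * (w i : ℝ) - (X i : ℝ)) / s) :=
    Finset.sum_le_sum_of_subset_of_nonneg (Finset.filter_subset _ _) fun i _ _ =>
      (Real.exp_pos _).le
  have hcard : (Nat.card {i // P i} : ℝ) = ((Finset.univ.filter P).card : ℝ) := by
    rw [Nat.card_eq_fintype_card, Fintype.card_subtype]
  rw [hcard]
  exact h1.trans h2

/-- Beyond some `n₁`, `3 ≤ e^{(c/2)√n}` (`n₁ = ⌈(2 log 3 / c)²⌉`). [folklore] -/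
private theorem exists_three_le_exp_half {c : ℝ} (hc : 0 < c) :
    ∃ n₁ : ℕ, ∀ n : ℕ, n₁ ≤ n → (3 : ℝ) ≤ Real.exp (c / 2 * Real.sqrt (n : ℝ)) := by
  -- adapted from `exists_six_le_exp` (SnSubsetDichotomyNoThresholdSubsetTriplePairWindowOfDeviation.lean)
  refine ⟨⌈(2 * Real.log 3 / c) ^ 2⌉₊, fun n hn => ?_⟩
  have hn' : (2 * Real.log 3 / c) ^ 2 ≤ (n : ℝ) := (Nat.le_ceil _).trans (by exact_mod_cast hn)
  have h0 : 0 ≤ 2 * Real.log 3 / c := by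
    have : 0 ≤ Real.log 3 := Real.log_nonneg (by norm_num)
    positivity
  have hsq : 2 * Real.log 3 / c ≤ Real.sqrt (n : ℝ) := by
    rw [← Real.sqrt_sq h0]
    exact Real.sqrt_le_sqrt hn'
  have hlog : Real.log 3 ≤ c / 2 * Real.sqrt (n : ℝ) := by
    have := mul_le_mul_of_nonneg_left hsq (le_of_lt (half_pos hc))
    calc Real.log 3 = c / 2 * (2 * Real.log 3 / c) := by field_simp
      _ ≤ c / 2 * Real.sqrt (n : ℝ) := this
  calc (3 : ℝ) = Real.exp (Real.log 3) := (Real.exp_log (by norm_num)).symm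
    _ ≤ Real.exp (c / 2 * Real.sqrt (n : ℝ)) := Real.exp_le_exp.2 hlog

/-- **One-point Chernoff functional → window count**, for an arbitrary family of `ℤ`-valued
`X n, w n` on finite types `α n`, each carrying a `w`-preserving bijection `e` with
`X (e i) − w i = −(X i − w i)`. If `∑_i e^{θ((2/3)w − X)/√n} ≤ n!·e^{-c√n}` for large `n`
(`θ, c > 0`), then with `a = ⌊(2w+2)/3⌋`,
`2·#{X < a} + #{2a ≤ X} ≤ n!·e^{-(c/2)√n}` for large `n`: both `{X < a}` and (through `e`)
`{2a ≤ X} ≃ {X ≤ 2w − 2a}` consist of indices with `3X ≤ 2w`, where the term is `≥ 1`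
(`card_le_sum_exp_tilt`), and `3 ≤ e^{(c/2)√n}` eventually. [folklore] -/
private theorem window_of_chernoff_abstract {α : ℕ → Type*} [∀ n, Fintype (α n)]
    (X w : ∀ n, α n → ℤ)
    (he : ∀ n, ∃ e : α n ≃ α n, ∀ i, w n (e i) = w n i ∧
      X n (e i) - w n (e i) = -(X n i - w n i))
    (h : ∃ θ : ℝ, 0 < θ ∧ ∃ c : ℝ, 0 < c ∧ ∃ n₀ : ℕ, ∀ n ≥ n₀,
      ∑ i : α n, Real.exp (θ * ((2 / 3 : ℝ) * (w n i : ℝ) - (X n i : ℝ)) / Real.sqrt (n : ℝ)) ≤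
        (n.factorial : ℝ) * Real.exp (-(c * Real.sqrt (n : ℝ)))) :
    ∃ c : ℝ, 0 < c ∧ ∃ n₀ : ℕ, ∀ n ≥ n₀,
      ((2 * Nat.card {i : α n // X n i < (2 * w n i + 2) / 3} +
          Nat.card {i : α n // 2 * ((2 * w n i + 2) / 3) ≤ X n i} : ℕ) : ℝ) ≤
        (n.factorial : ℝ) * Real.exp (-(c * Real.sqrt (n : ℝ))) := by
  obtain ⟨θ, hθ, c, hc, n₀, hS⟩ := h
  obtain ⟨n₁, hn₁⟩ := exists_three_le_exp_half hc
  refine ⟨c / 2, half_pos hc, max n₀ n₁, fun n hn => ?_⟩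
  obtain ⟨hn₀', hn₁'⟩ : n₀ ≤ n ∧ n₁ ≤ n := by simpa only [ge_iff_le, max_le_iff] using hn
  obtain ⟨e, he⟩ := he n
  -- lower count: `X < a` forces `3X ≤ 2w`
  have hlow : (Nat.card {i : α n // X n i < (2 * w n i + 2) / 3} : ℝ) ≤
      ∑ i : α n, Real.exp (θ * ((2 / 3 : ℝ) * (w n i : ℝ) - (X n i : ℝ)) / Real.sqrt (n : ℝ)) :=
    card_le_sum_exp_tilt (X n) (w n) _ (fun i hi => by omega) hθ.le (Real.sqrt_nonneg _)
  -- upper count: `{2a ≤ X} ≃ {X ≤ 2w − 2a}` along `e`, and `X ≤ 2w − 2a` forces `3X ≤ 2w`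
  have hcongr : Nat.card {i : α n // 2 * ((2 * w n i + 2) / 3) ≤ X n i} =
      Nat.card {i : α n // X n i ≤ 2 * w n i - 2 * ((2 * w n i + 2) / 3)} :=
    Nat.card_congr (e.subtypeEquiv fun i => by
      obtain ⟨h1, h2⟩ := he i
      constructor <;> intro <;> omega)
  have hupp : (Nat.card {i : α n // 2 * ((2 * w n i + 2) / 3) ≤ X n i} : ℝ) ≤
      ∑ i : α n, Real.exp (θ * ((2 / 3 : ℝ) * (w n i : ℝ) - (X n i : ℝ)) / Real.sqrt (n : ℝ)) := by
    rw [hcongr]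
    exact card_le_sum_exp_tilt (X n) (w n) _ (fun i hi => by omega) hθ.le (Real.sqrt_nonneg _)
  -- constants: `3·n!·e^{-c√n} ≤ e^{(c/2)√n}·n!·e^{-c√n} = n!·e^{-(c/2)√n}`
  have hSn := hS n hn₀'
  have hf : (0 : ℝ) ≤ (n.factorial : ℝ) * Real.exp (-(c * Real.sqrt (n : ℝ))) := by positivity
  have hEF : 3 * ((n.factorial : ℝ) * Real.exp (-(c * Real.sqrt (n : ℝ)))) ≤
      Real.exp (c / 2 * Real.sqrt (n : ℝ)) *
        ((n.factorial : ℝ) * Real.exp (-(c * Real.sqrt (n : ℝ)))) :=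
    mul_le_mul_of_nonneg_right (hn₁ n hn₁') hf
  have key : Real.exp (c / 2 * Real.sqrt (n : ℝ)) *
        ((n.factorial : ℝ) * Real.exp (-(c * Real.sqrt (n : ℝ)))) =
      (n.factorial : ℝ) * Real.exp (-(c / 2 * Real.sqrt (n : ℝ))) := by
    rw [mul_left_comm, ← Real.exp_add]
    congr 1
    ring_nf
  push_cast
  linarith [hlow, hupp, hSn, hEF, key]

end KlrLine

set_option linter.dupNamespace false in -- deliberate Summit.<S>.<P> duplicate
open KlrLine in
/-- **Stub `stub_window_of_onePointChernoff` (bridge of line `one-point-chernoff`, crux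
`SnSubsetDichotomy.NoThresholdSubsetTriple`, stmt-MatrixMultiplication-8302): the one-point
Chernoff functional (C1) controls the window count.** With `X = deg₂ S + deg₂ T`
(`TableauPair.degree 2`), `w = c₀ − (c₀ − c₁)²` the `2`-block weight
(`cⱼ = TableauPair.content 2 · j`) and the cut `a = ⌊(2w+2)/3⌋`: if for some `θ > 0`, `c > 0`
and all large `n`, `∑_{(μ,S,T) ⊢ n} exp(θ·((2/3)w − X)/√n) ≤ n!·e^{-c√n}`, then
`2·#{X < a} + #{2a ≤ X} ≤ n!·e^{-c'√n}` for some `c' > 0` and all large `n`. Proof: Markov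
(indicator ≤ exponential, `X < a ⟹ 3X ≤ 2w`) for the lower count; for the upper count the
content-preserving transpose bijection with `X ↦ 2w − X`
(`KlrLine.exists_equiv_degree_sub_weight_neg`) carries `{2a ≤ X}` onto `{X ≤ 2w − 2a}`, where
again `3X ≤ 2w`; so the window count is `≤ 3·n!·e^{-c√n} ≤ n!·e^{-(c/2)√n}`. The special case
of `window_of_chernoff_abstract`. [folklore] -/
theorem stub_window_of_onePointChernoff :
    (∃ θ : ℝ, 0 < θ ∧ ∃ c : ℝ, 0 < c ∧ ∃ n₀ : ℕ, ∀ n ≥ n₀, ∑ i : Literature.RepresentationTheory.FiniteGroups.TableauPair n, Real.exp (θ * ((2 / 3 : ℝ) * (((Literature.RepresentationTheory.FiniteGroups.TableauPair.content 2 i 0 : ℤ) - ((Literature.RepresentationTheory.FiniteGroups.TableauPair.content 2 i 0 : ℤ) - (Literature.RepresentationTheory.FiniteGroups.TableauPair.content 2 i 1 : ℤ)) ^ 2) : ℝ) - (Literature.RepresentationTheory.FiniteGroups.TableauPair.degree 2 i : ℝ)) / Real.sqrt (n : ℝ)) ≤ (n.factorial : ℝ) * Real.exp (-(c * Real.sqrt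 (n : ℝ)))) →
    (∃ c : ℝ, 0 < c ∧ ∃ n₀ : ℕ, ∀ n ≥ n₀, ((2 * Nat.card {i : Literature.RepresentationTheory.FiniteGroups.TableauPair n // Literature.RepresentationTheory.FiniteGroups.TableauPair.degree 2 i < (2 * ((Literature.RepresentationTheory.FiniteGroups.TableauPair.content 2 i 0 : ℤ) - ((Literature.RepresentationTheory.FiniteGroups.TableauPair.content 2 i 0 : ℤ) - (Literature.RepresentationTheory.FiniteGroups.TableauPair.content 2 i 1 : ℤ)) ^ 2) + 2) / 3} + Nat.card {i : Literature.RepresentationTheory.FiniteGroups.TableauPair n // 2 * ((2 * ((Literature.RepresentationTheory.FiniteGroups.TableauPair.content 2 i 0 : ℤ) - ((Literature.RepresentationTheory.FiniteGroups.TableauPair.content 2 i 0 : ℤ) - (Literature.RepresentationTheory.FiniteGroups.TableauPair.content 2 i 1 : ℤ)) ^ 2) + 2) / 3) ≤ Literature.RepresentationTheory.FiniteGroups.TableauPair.degree 2 i} : ℕ) : ℝ) ≤ (n.factorial : ℝ) * Real.exp (-(c * Real.sqrt (n : ℝ)))) := by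
  intro h
  refine window_of_chernoff_abstract (α := TableauPair)
    (fun n (i : TableauPair n) => TableauPair.degree 2 i)
    (fun n (i : TableauPair n) => (TableauPair.content 2 i 0 : ℤ) -
      ((TableauPair.content 2 i 0 : ℤ) - (TableauPair.content 2 i 1 : ℤ)) ^ 2)
    (fun n => ?_) ?_
  · -- the transpose bijection preserves the content, hence `w`, and negates `X − w`
    obtain ⟨e, he⟩ := KlrLine.exists_equiv_degree_sub_weight_neg n
    exact ⟨e, fun i => ⟨by simp only [(he i).1], (he i).2⟩⟩
  · -- (C1), with the cast `ℤ → ℝ` of `w` pushed to the contents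
    simpa only [Int.cast_sub, Int.cast_pow] using h

end Summit.MatrixMultiplication.MatrixMultiplication.Theorems
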